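import Mathlib
import Summits.HodgeConjecture.HodgeConjecture.Theses.EndoscopicMiddleDegree

/-!
# Sketch — first lemmas of ideator 2's crux ideas for `EndoscopicMiddleDegree.MiddleThetaSpan`
(crux item stmt-HodgeConjecture-13661; round 1, ideator k = 2).

* idea `hecke-saturation`: `typedSpan`, `middleThetaSpan_iff` (the crux, restated by name, `Iff.rfl`),
  `typedSpan_map_le_of_middleThetaSpan` (NECESSITY, proved: the crux forces the typed span to be
  stable under every endomorphism preserving rational Hodge `(n,n)`-classes — e.g. every Hecke
  correspondence at level `Γ`), `SaturationCriterion` (the module-theoretic SUFFICIENCY criterion,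
  stated: a submodule of an isotypic semisimple module `Sⁿ`, `S` simple, is everything iff no
  non-zero equivariant map to `S` kills it).
* idea `dichotomy-coherence`: `dichotomyCoherence` (the sign bookkeeping: automorphy sign ×
  conjugate-orthogonal root number = coherence of the local theta-dichotomy data, proved) and
  `pin_of_finrank_le` (multiplicity one pins the automorphic realisation: a subspace of the same
  dimension is everything, proved from Mathlib).
No automorphic object is formalised here (none exists in the tree); these are the typable shadows.
-/

noncomputable section

namespace Summit.HodgeConjecture.HodgeConjecture.Cruxes.MiddleThetaSpan.IdeatorTwo

open Literature.AlgebraicGeometry.HodgeTheory Literature.AlgebraicGeometry.ShimuraVarieties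
  Literature.AlgebraicGeometry.Motives Literature.AlgebraicTopology.SingularHomology

/-- The TYPED SPAN of the crux at `(m, X, D)`: `SC^{m+1}(D) ⊔ span{s ∪ d} ⊔ span{a ∪ d}` exactly as in
`EndoscopicMiddleDegree.MiddleThetaSpan`. -/
def typedSpan (m : ℕ) (X : SchemeOver ℂ) (D : UnitaryBallQuotientDatum (2 * (m + 1)) X) :
    Submodule ℂ (complexBetti X (2 * (m + 1))) :=
  (⨆ (W : Submodule D.E (Fin (2 * (m + 1) + 1) → D.E))
      (_ : IsTotallyPositive (conjRingHom D.E) D.H W) (_ : Module.finrank D.E W = m + 1),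
      classesSupportedOn X (D.specialSubvariety W) (2 * (m + 1))) ⊔
  Submodule.span ℂ {z : complexBetti X (2 * (m + 1)) |
    ∃ s ∈ (⨆ (W : Submodule D.E (Fin (2 * (m + 1) + 1) → D.E))
      (_ : IsTotallyPositive (conjRingHom D.E) D.H W) (_ : Module.finrank D.E W = m),
      classesSupportedOn X (D.specialSubvariety W) (2 * m)),
    ∃ d ∈ algebraicClasses X 1, z = cupProduct (two_mul_add_two_mul m 1) s d} ⊔
  Submodule.span ℂ {z : complexBetti X (2 * (m + 1)) |
    ∃ a : complexBetti X (2 * m), IsRationalClass a ∧ IsOfHodgeType (2 * (m + 1)) X (2 * m) m m a ∧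
      ∃ d ∈ algebraicClasses X 1, z = cupProduct (two_mul_add_two_mul m 1) a d}

/-- The ℂ-span of the rational Hodge `(m+1,m+1)`-classes in the middle degree. -/
def hodgeSpan (m : ℕ) (X : SchemeOver ℂ) : Submodule ℂ (complexBetti X (2 * (m + 1))) :=
  Submodule.span ℂ {c : complexBetti X (2 * (m + 1)) |
    IsRationalClass c ∧ IsOfHodgeType (2 * (m + 1)) X (2 * (m + 1)) (m + 1) (m + 1) c}

/-- Sanity: the crux, by name, is membership in `typedSpan`. -/
theorem middleThetaSpan_iff :
    Theses.EndoscopicMiddleDegree.MiddleThetaSpan ↔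
      ∀ (m : ℕ) (X : SchemeOver ℂ) (D : UnitaryBallQuotientDatum (2 * (m + 1)) X), 1 ≤ m → m ≤ 2 →
        ∀ c : complexBetti X (2 * (m + 1)), IsRationalClass c →
          IsOfHodgeType (2 * (m + 1)) X (2 * (m + 1)) (m + 1) (m + 1) c → c ∈ typedSpan m X D :=
  Iff.rfl

/-- FIRST LEMMA of idea `hecke-saturation` (necessity half, proved). If the crux holds, then at every
`(m, X, D)` in range where the typed span consists of (combinations of) rational Hodge classes — true:
its generators are algebraic cycle classes — the typed span is stable under EVERY ℂ-linear
endomorphism `T` of `H^{2(m+1)}(X(ℂ); ℂ)` that maps rational Hodge `(m+1,m+1)`-classes to rational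
Hodge `(m+1,m+1)`-classes. Hecke correspondences at level `Γ` (finite algebraic correspondences
`X ← X_{Γ ∩ gΓg⁻¹} → X`) are such `T`; so is any algebraic self-correspondence of `X`. Contrapositive
= the cheapest kill of the typed rendering: ONE Hecke operator moving ONE product of two divisor
classes out of the typed span refutes `MiddleThetaSpan` as typed (a `misstated`-class refutation;
repair = Hecke-saturate the second and third summands). -/
theorem typedSpan_map_le_of_middleThetaSpan
    (h : Theses.EndoscopicMiddleDegree.MiddleThetaSpan)
    (m : ℕ) (X : SchemeOver ℂ) (D : UnitaryBallQuotientDatum (2 * (m + 1)) X)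
    (hm : 1 ≤ m) (hm' : m ≤ 2) (hle : typedSpan m X D ≤ hodgeSpan m X)
    (T : complexBetti X (2 * (m + 1)) →ₗ[ℂ] complexBetti X (2 * (m + 1)))
    (hT : ∀ c : complexBetti X (2 * (m + 1)), IsRationalClass c →
      IsOfHodgeType (2 * (m + 1)) X (2 * (m + 1)) (m + 1) (m + 1) c →
        IsRationalClass (T c) ∧ IsOfHodgeType (2 * (m + 1)) X (2 * (m + 1)) (m + 1) (m + 1) (T c)) :
    (typedSpan m X D).map T ≤ typedSpan m X D := by
  have h1 : hodgeSpan m X ≤ typedSpan m X D :=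
    Submodule.span_le.mpr fun c hc => h m X D hm hm' c hc.1 hc.2
  calc (typedSpan m X D).map T ≤ (hodgeSpan m X).map T := Submodule.map_mono hle
    _ ≤ hodgeSpan m X := by
        rw [hodgeSpan, Submodule.map_span]
        refine Submodule.span_mono ?_
        rintro _ ⟨c, hc, rfl⟩
        exact hT c hc.1 hc.2
    _ ≤ typedSpan m X D := h1

/-- Idea `hecke-saturation`, SUFFICIENCY criterion (module theory; stated, not proved here —
standard: the lattice of `A`-submodules of `Sⁿ`, `S` simple with `D = End_A(S)`, is the lattice of
`D`-subspaces of `Dⁿ`). Reading: `A = ℋ_Γ ⊗ ℂ` (level-`Γ` Hecke algebra), `S = π_f^Γ` (simple over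
`ℋ_Γ` for `π_f` irreducible), `Sⁿ ≅ H^{2n}(X; ℂ)[π_f] ∩ (Hodge-rational part)` with `n` = multiplicity,
`W` = the Hecke-saturation of the typed span inside it; the maps `f` are "take the `λ`-coordinate of
the multiplicity space": the criterion says ONE vector of the typed span with non-zero
`(π_f, λ)`-component for each `λ` — one test vector — suffices once the span is a Hecke module. -/
def SaturationCriterion : Prop :=
  ∀ (A : Type) [Ring A] (S : Type) [AddCommGroup S] [Module A S], IsSimpleModule A S →
    ∀ (n : ℕ) (W : Submodule A (Fin n → S)),
      (∀ f : (Fin n → S) →ₗ[A] S, f ≠ 0 → W.map f ≠ ⊥) → W = ⊤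

/-- FIRST LEMMA of idea `dichotomy-coherence` (the sign bookkeeping, proved). Index set `ι` = the
places of `F` (finitely many carry a sign `≠ 1`); `η v` = the Arthur/KMSW label of `π_v` evaluated at
the element `s_{χ₀}` of the global component group (`∏ η = ε_ψ(s_{χ₀}) = 1`: multiplicity formula for
the AUTOMORPHIC `π`, generic `ψ`); `e v` = the GGP-normalised local root number
`ε_v(1/2, Ψ'_v ⊗ χ₀,v⁻¹, ψ_v)` (`∏ e = 1`: global root number of a conjugate-ORTHOGONAL representation);
`η v * e v` = the Gan–Ichino/Harris–Kudla–Sweet dichotomy sign telling WHICH `2n`-dimensional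
hermitian `W_v^±` receives `θ(π_v)`. Conclusion: the local dichotomy winners are COHERENT (come from a
global `W`). -/
theorem dichotomyCoherence {ι : Type*} [Fintype ι] (η e : ι → ℤˣ)
    (hη : ∏ v, η v = 1) (he : ∏ v, e v = 1) : ∏ v, η v * e v = 1 := by
  rw [Finset.prod_mul_distrib, hη, he, one_mul]

/-- Idea `dichotomy-coherence`, the pinning step (proved from Mathlib): multiplicity one for `π` on
`U(V)` (KMSW) says the `π_f`-isotypic automorphic — hence cohomological — space `U` has dimension
`dim π_f^Γ · 1`; the classes of the global theta lift `Θ_W(σ) ≅ π` span a subspace `Θ ≤ U` of that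
same dimension; so `Θ = U`: EVERY `(n,n)`-class of `π` is a theta class (then BMM Thm 69 = StepTwo
makes it a Kudla–Millson special theta class). -/
theorem pin_of_finrank_le {V : Type*} [AddCommGroup V] [Module ℂ V] [FiniteDimensional ℂ V]
    {Θ U : Submodule ℂ V} (hle : Θ ≤ U) (hdim : Module.finrank ℂ U ≤ Module.finrank ℂ Θ) :
    Θ = U :=
  Submodule.eq_of_le_of_finrank_le hle hdim

end Summit.HodgeConjecture.HodgeConjecture.Cruxes.MiddleThetaSpan.IdeatorTwo

end
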